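import Literature.AlgebraicGeometry.ShimuraVarieties.UnitaryShimuraIdentityPieceReduction
import HarnessLib

/-!
# Reduction to the identity piece, ASSEMBLED: from a class detected on one piece of `(M_{K″})_τ` to the identity piece of a
# conjugate level, through ONE Hecke-translate isomorphism ([Deligne1979ShimuraVarieties] 2.1.2–2.1.4; [Milne2005ShimuraVarieties] §5, Thm. 13.6)

Topic `AlgebraicGeometry/ShimuraVarieties`; namespace `Literature.AlgebraicGeometry.ShimuraVarieties.UnitaryCanonicalModel` (the rank-3 ★
`RecordSystem` of Deligne's canonical model of `Sh(U(H), 𝔹²)`).  PROOF FILE: theorems only — no definition, no named fact, no instance, no `sorry`.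

Continuation of `UnitaryShimuraIdentityPieceReduction.lean` ((7d-asm) of the GS programme of the cell `hodgecm-mathlib`, crux `HLiu418`
24832, clause (1) of the seesaw input `S34SomeSource`).  That file supplies the three bookkeeping steps of the (β′) device — (A) right
translation by `b` descends on the index sets, (B) `exists_conj_rep_of_normalised` (every class of `Ξ_{K″}` has a representative `b` with
`bK″b⁻¹ ⊆ K₀`, given the (L4) shrink `C5.exists_smallLevel_le_normalised_conj_le`), (C)
`RecordSystem.complexBetti_map_identityPiece_ne_zero_of_heckeTranslateIso` — and `UnitaryShimuraHeckeTranslateIso.lean` supplies (L2)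
`RecordSystem.exists_iso_heckeLevel` (the translate `T_b : M_{bK″b⁻¹ ∩ K₀} ⟶ M_{K″}` is an ISOMORPHISM of levels, [Milne2005ShimuraVarieties]
Thm. 13.6 p. 118 with §5 p. 58 L6–11).  Here the three are COMPOSED into the one statement the clause-(1) closer consumes:

* `RecordSystem.exists_heckeTranslateIso_identityPiece_ne_zero` — for a record system whose Hecke translates are defined over `L`
  (`hS : S.HeckeTranslateDefinedOver`), a level `K″` normalised by `K′` with representatives `g′_q` of `Ξ_{K′}` satisfying `g′_q K″ g′_q⁻¹ ⊆ K₀`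
  (the (L4) output), a pieces presentation of `(M_{K″})_τ` (legs `ι″` of a colimit cofan whose summands carry ball data with `Hℂ = H^τ` and
  the `pieces` points clause through representatives `g″_q` — the shape of `HComp.RecordSystem.exists_pieces_fieldRange`) and a class
  `x ∈ Hⁿ((M_{K″})_τ(ℂ); ℂ)` non-zero ON SOME PIECE `q″`: there are `b` with `bK″b⁻¹ ⊆ K₀` and an isomorphism of levels
  `e : M_Λ ≅ M_{K″}`, `Λ := bK″b⁻¹ ∩ K₀` (`C5.heckeLevel b K″`), `e.hom` a `b`-translate and `e.inv` a `b⁻¹`-translate, such that for EVERY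
  pieces presentation of `(M_Λ)_τ` and every leg `ι q₁` through a representative of the IDENTITY class `[1]_Λ`:
  `((e.hom)_τ^* x)|_{q₁} ≠ 0`.

With ★ (L4) and the cofan detection of a non-zero class on some piece, the (7d) step of the closer is this ONE `obtain`.  HC_CM is NOT proved
here; nothing in this file discharges a printed-citation binder by itself.

## References
* [Deligne1979ShimuraVarieties] P. Deligne, *Variétés de Shimura* (1979), 2.1.2–2.1.4.
* [Milne2005ShimuraVarieties] J. S. Milne, *Introduction to Shimura varieties* (rev. 2017): Lemma 5.13 p. 57, §5 p. 58 L6–11, §13 Thm. 13.6 p. 118 L21–28.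
* [GortzWedhorn2020] U. Görtz, T. Wedhorn, *Algebraic Geometry I* (2nd ed.), §(3.5) Example 3.11 (coproducts of schemes).
-/

set_option autoImplicit false

noncomputable section

open Function MulAction Topology NumberField CategoryTheory CategoryTheory.Limits Matrix AlgebraicGeometry
open scoped Matrix ComplexOrder
open Literature.AlgebraicGeometry.Motives
open Literature.NumberTheory.Automorphic Literature.NumberTheory.Automorphic.UnitaryGroup
open Literature.NumberTheory.Automorphic.Liu2021.AppendixC (C5.OpenCompactSubgroup C5.SmallLevel)
open Literature.Geometry.ComplexHyperbolic Literature.Geometry.ComplexHyperbolic.BallModel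
open Literature.NumberTheory.Automorphic.ShimuraDissection

namespace Literature.AlgebraicGeometry.ShimuraVarieties.UnitaryCanonicalModel

variable {L : Type} [Field L] [NumberField L] [IsCMField L] {H : Matrix (Fin 3) (Fin 3) L}
  {τ : L →+* ℂ} {T : GL (Fin 3) ℂ} {hT : formCongr (starRingEnd ℂ) T (H.map τ) = BallModel.J}
  {K₀ : C5.OpenCompactSubgroup ↥(finAdelic (↥(maximalRealSubfield L)) L (IsCMField.complexConj L) 3 H)}

namespace RecordSystem

/-- **From a class detected on ONE piece of `(M_{K″})_τ` to the IDENTITY piece of a conjugate level, through a Hecke-translate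
isomorphism.**  Let `S` be a record system of Deligne's canonical model with Hecke translates defined over `L` (`hS`), `K″` a level normalised by
`K′` whose class representatives `g′_q` satisfy `g′_q K″ g′_q⁻¹ ⊆ K₀` (the (L4) shrink), `(Y″, D″, ι″, g″)` a pieces presentation of `(M_{K″})_τ`
(colimit cofan of ball quotients with `Hℂ = H^τ` and the `pieces` points clause), and `x ∈ Hⁿ((M_{K″})_τ(ℂ); ℂ)` with `x|_{Y″_{q″}} ≠ 0`.  Then for
`b := γ⁻¹ g″_{q″}`-style representative of `[g″_{q″}]_{K″}` with `bK″b⁻¹ ⊆ K₀` ((B)) the translate `T_b : M_Λ ⟶ M_{K″}`, `Λ = bK″b⁻¹ ∩ K₀`, is an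
isomorphism `e` ((L2), [Milne2005ShimuraVarieties] Thm. 13.6 + §5 p. 58), and `(e.hom)_τ^* x` is non-zero on EVERY leg through the identity class
`[1]_Λ` of EVERY pieces presentation of `(M_Λ)_τ` ((C)).
[cite: Milne2005ShimuraVarieties, Thm. 13.6 p. 118 L21–28; §5 p. 58 L6–11; Lemma 5.13 p. 57] [cite: Deligne1979ShimuraVarieties, 2.1.2–2.1.4]
[cite: GortzWedhorn2020, §(3.5) Example 3.11] -/
theorem exists_heckeTranslateIso_identityPiece_ne_zero (S : RecordSystem L H τ T hT K₀) (hS : S.HeckeTranslateDefinedOver)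
    {K' K'' : C5.SmallLevel K₀}
    (hnorm : ∀ k ∈ K'.1.1, ∀ n ∈ K''.1.1, k⁻¹ * n * k ∈ K''.1.1)
    (g' : orbitRel.Quotient (rational (↥(maximalRealSubfield L)) L (IsCMField.complexConj L) 3 H)
          (CosetSpace (rationalToFinAdelic (↥(maximalRealSubfield L)) L (IsCMField.complexConj L) 3 H) K'.1.1) →
        finAdelic (↥(maximalRealSubfield L)) L (IsCMField.complexConj L) 3 H)
    (hg' : ∀ q, Quotient.mk'' (CosetSpace.pt (rationalToFinAdelic _ L _ 3 H) K'.1.1 (g' q)) = q)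
    (hg0 : ∀ q, ∀ n ∈ K''.1.1, g' q * n * (g' q)⁻¹ ∈ K₀.1)
    {Ξ'' : Type} {Y'' : Ξ'' → SchemeOver ℂ} (D'' : ∀ q, UnitaryBallUniformisationDatum 2 (Y'' q))
    {ι'' : ∀ q, Y'' q ⟶ (Motives.baseChangeHom τ).obj (S.M.obj K'')}
    (hcol'' : IsColimit (Cofan.mk ((Motives.baseChangeHom τ).obj (S.M.obj K'')) ι''))
    (g'' : Ξ'' → finAdelic (↥(maximalRealSubfield L)) L (IsCMField.complexConj L) 3 H)
    (hD'' : ∀ q, (D'' q).Hℂ = H.map τ)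
    (hι'' : letI : Algebra L ℂ := τ.toAlgebra
      ∀ (q : Ξ'') (z : Ball), AlgPoints.map (L := ℂ) (ι'' q) ((D'' q).unif ((T : Matrix (Fin 3) (Fin 3) ℂ) *ᵥ BallModel.lift z)) =
        AlgPoints.baseChangeEquiv τ (S.M.obj K'') ((S.pts K'').symm (ShimuraSet.mk L H τ T hT K''.1.1 z (g'' q))))
    (n : ℕ) {x : HodgeTheory.complexBetti ((Motives.baseChangeHom τ).obj (S.M.obj K'')) n} (q'' : Ξ'')
    (hx : (HodgeTheory.complexBetti.map (ι'' q'') n).hom x ≠ 0) :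
    ∃ (b : finAdelic (↥(maximalRealSubfield L)) L (IsCMField.complexConj L) 3 H)
      (_ : ∀ y ∈ K''.1.1, b * y * b⁻¹ ∈ K₀.1)
      (e : S.M.obj (Liu2021.AppendixC.C5.heckeLevel b K'') ≅ S.M.obj K''),
      S.IsHeckeTranslate (Liu2021.AppendixC.C5.heckeLevel b K'') K'' b e.hom ∧
      S.IsHeckeTranslate K'' (Liu2021.AppendixC.C5.heckeLevel b K'') b⁻¹ e.inv ∧
      ∀ {Ξ : Type} {Y : Ξ → SchemeOver ℂ}
        {ι : ∀ q, Y q ⟶ (Motives.baseChangeHom τ).obj (S.M.obj (Liu2021.AppendixC.C5.heckeLevel b K''))}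
        (D : ∀ q, UnitaryBallUniformisationDatum 2 (Y q))
        (_ : IsColimit (Cofan.mk ((Motives.baseChangeHom τ).obj (S.M.obj (Liu2021.AppendixC.C5.heckeLevel b K''))) ι))
        (q₁ : Ξ) (_ : (D q₁).Hℂ = H.map τ) (a : finAdelic (↥(maximalRealSubfield L)) L (IsCMField.complexConj L) 3 H)
        (_ : (Quotient.mk'' (CosetSpace.pt (rationalToFinAdelic _ L _ 3 H) (Liu2021.AppendixC.C5.heckeLevel b K'').1.1 a) :
            orbitRel.Quotient (rational (↥(maximalRealSubfield L)) L (IsCMField.complexConj L) 3 H)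
              (CosetSpace (rationalToFinAdelic (↥(maximalRealSubfield L)) L (IsCMField.complexConj L) 3 H)
                (Liu2021.AppendixC.C5.heckeLevel b K'').1.1)) =
          Quotient.mk'' (CosetSpace.pt (rationalToFinAdelic _ L _ 3 H) (Liu2021.AppendixC.C5.heckeLevel b K'').1.1 1))
        (_ : letI : Algebra L ℂ := τ.toAlgebra
          ∀ z : Ball, AlgPoints.map (L := ℂ) (ι q₁) ((D q₁).unif ((T : Matrix (Fin 3) (Fin 3) ℂ) *ᵥ BallModel.lift z)) =
            AlgPoints.baseChangeEquiv τ (S.M.obj (Liu2021.AppendixC.C5.heckeLevel b K''))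
              ((S.pts (Liu2021.AppendixC.C5.heckeLevel b K'')).symm
                (ShimuraSet.mk L H τ T hT (Liu2021.AppendixC.C5.heckeLevel b K'').1.1 z a))),
        (HodgeTheory.complexBetti.map (ι q₁) n).hom
          ((HodgeTheory.complexBetti.map ((Motives.baseChangeHom τ).map e.hom) n).hom x) ≠ 0 := by
  -- (B): a representative `b` of `[g″_{q″}]_{K″}` with `bK″b⁻¹ ⊆ K₀`
  obtain ⟨b, hb, hbq⟩ := ShimuraSet.exists_conj_rep_of_normalised L H hnorm g' hg' hg0 (g'' q'')
  -- (L2): the translate `T_b : M_Λ ⟶ M_{K″}` is an isomorphism of levels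
  obtain ⟨e, he, he'⟩ := S.exists_iso_heckeLevel hS K'' b hb
  refine ⟨b, hb, e, he, he', fun D hcol q₁ hD a ha hι => ?_⟩
  -- (C): the class moves to the identity piece of `Λ`
  exact S.complexBetti_map_identityPiece_ne_zero_of_heckeTranslateIso (Liu2021.AppendixC.C5.heckeLE_heckeLevel b K'') e he D hcol
    D'' hcol'' q₁ hD a ha hι q'' (hD'' q'') (g'' q'') hbq (hι'' q'') n hx

end RecordSystem

end Literature.AlgebraicGeometry.ShimuraVarieties.UnitaryCanonicalModel

end
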